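import Literature.AnabelianGeometry.EtaleTheta.SettingBridgeCuspLaws
import Literature.AnabelianGeometry.EtaleTheta.SettingModelChiThetaCuspOncePunctured
import Literature.AnabelianGeometry.EtaleTheta.SettingModelTateThetaCuspOncePunctured
import Literature.AnabelianGeometry.EtaleTheta.SettingModelTateCensusClauses
import HarnessLib

/-!
# The cusp laws `ThetaSetting.CuspLaws` at the χ-models WITH a cusp (`modelχ′`, `modelχq′`): the
# «unique cusp» and «section» legs HOLD, the «inertia onto `Δ_Θ`» leg FAILS — so `¬ CuspLaws` there
# (non-vacuity bookkeeping for the 13:00Z census items C16 / C9 / C3; proof-only)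

S. Mochizuki, *The étale theta function …*, Publ. RIMS **45** (2009) [EtTh], Def. 2.1 preamble p. 35
(«the unique cusp of `X^log`», «`D_x → Π^Θ_X` … maps the inertia group `I_x ⊆ D_x` isomorphically onto
`Δ_Θ`»), Prop. 2.2 (ii) p. 37 [cite: MochizukiEtTh2009, Def 2.1 p.35].

Cell abc-iut, layer L2 (NV lane), seat abc-iut-L2-t7 (gen 4) — owner of `OncePuncturedData` and filer of
the predicate bundle `ThetaSetting.CuspLaws` (`SettingBridgeCuspLaws`).  PROOF-ONLY (0 definitions):
the truth table of the three legs at the two NAMED cusped χ-models of the R78 cluster, read off the landed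
model files BY NAME (abc-iut-w5-d029's `SettingModelChiThetaCusp` / `SettingModelTateThetaCusp`, abc-iut-w5-d111's
`…OncePunctured` bundles, abc-iut-L2-t10's census clauses `SettingModelChiCensusClauses` /
`SettingModelTateCensusClauses`):

* `cusp_unique_modelχ'`, `cusp_unique_modelχq'` — leg C16 HOLDS (`Pt := Unit`);
* `exists_continuous_section_modelχ'`, `…_modelχq'` — leg C9 HOLDS (the section `σ ↦ (1, σ)` of the
  semidirect product, abc-iut-w5-d029 / abc-iut-w5-d249 `continuous_inrχ`, `continuous_inrχq`);
* `not_map_toTheta_inertia_modelχ'`, `…_modelχq'` — leg C3 FAILS at the toral cusp `b^Ẑ ⋊ G_{ℚ_p}`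
  (from the per-`l` refutations `not_inertiaClause_modelχ'` / `not_inertiaClause_curveχq'` at `l = 2` through
  `CuspLaws`-free `inertiaClause_of_map_toTheta`, compactness of `D_x` from the bundle);
* `not_cuspLaws_modelχ'`, `not_cuspLaws_modelχq'` — hence the bundle's v-next predicate is FALSE at both
  cusped χ-models (the census's disclosed cost of C3), although `OncePuncturedData` is inhabited there.

HONEST LABEL: semi-synthetic models, consistency bookkeeping only; nothing of [EtTh] asserted; no side taken
on [IUTchIII] Cor. 3.12.
-/

noncomputable section

namespace Literature.AnabelianGeometry.EtaleTheta.SettingModel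

open Literature.AnabelianGeometry.SemiGraphs _root_.Topology

variable (p : ℕ) [Fact p.Prime]

/-! ### Stage 1: `modelχ′` -/

/-- Leg C16 at `modelχ′`: the cusp is unique (`Pt := Unit`). [cite: MochizukiEtTh2009, Def 2.1 p.35] -/
theorem cusp_unique_modelχ' :
    ∀ x x' : (ThetaSetting.modelχ' p).Pt, (ThetaSetting.modelχ' p).IsCusp x →
      (ThetaSetting.modelχ' p).IsCusp x' → x' = x :=
  fun _ _ _ _ => rfl

/-- Leg C9 at `modelχ′`: a continuous section `σ ↦ (1, σ)` of `D_x = b^Ẑ ⋊ G_{ℚ_p} ↠ G_K`.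
[cite: MochizukiEtTh2009, Prop 2.2(ii) p.37] -/
theorem exists_continuous_section_modelχ' :
    ∀ x : (ThetaSetting.modelχ' p).Pt, (ThetaSetting.modelχ' p).IsCusp x →
      ∃ s : ↥(ThetaSetting.modelχ' p).GK →* (ThetaSetting.modelχ' p).PiTemp, Continuous s ∧
        (∀ σ, s σ ∈ (ThetaSetting.modelχ' p).decomp x) ∧
        ∀ σ, (ThetaSetting.modelχ' p).aug (s σ) = (σ : GQp p) := by
  intro x _
  refine ⟨(SemidirectProduct.inr : GQp p →* PiTpχ p).comp (ThetaSetting.modelχ' p).GK.subtype,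
    (continuous_inrχ p).comp continuous_subtype_val, fun σ => ?_, fun σ => rfl⟩
  exact inr_mem_cuspDecomp (actχ p) (actχ_stabilises p) (σ : GQp p)

/-- Leg C3 FAILS at `modelχ′`: `toTheta(I_x) ≠ Δ_Θ` at the toral cusp (else the per-`l` clause at `l = 2`
would hold, against `not_inertiaClause_modelχ'`). [cite: MochizukiEtTh2009, Def 2.1 p.35] -/
theorem not_map_toTheta_inertia_modelχ' (x : (ThetaSetting.modelχ' p).Pt) :
    ¬ ((ThetaSetting.modelχ' p).inertia x).map (ThetaSetting.modelχ' p).toTheta =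
        (ThetaSetting.modelχ' p).DeltaTheta := fun h =>
  not_inertiaClause_modelχ' p 2 le_rfl x
    ((ThetaSetting.modelχ' p).inertiaClause_of_map_toTheta x
      ((nonempty_oncePuncturedData_modelχ' p).some.isCompact_decomp x) h 2 two_pos)

/-- **`¬ CuspLaws` at `modelχ′`** (through its C3 leg), although `OncePuncturedData` is inhabited there
(`nonempty_oncePuncturedData_modelχ'`). [cite: MochizukiEtTh2009, Def 2.1 p.35] -/
theorem not_cuspLaws_modelχ' : ¬ (ThetaSetting.modelχ' p).CuspLaws := fun hL =>
  not_map_toTheta_inertia_modelχ' p () (hL.map_toTheta_inertia () trivial)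

/-- The truth table at `modelχ′`: C16 ∧ C9 ∧ ¬C3 (at the cusp) ∧ ¬CuspLaws ∧ bundle inhabited.
[cite: MochizukiEtTh2009, Def 2.1 p.35] -/
theorem cuspLaws_census_modelχ' :
    (∀ x x' : (ThetaSetting.modelχ' p).Pt, (ThetaSetting.modelχ' p).IsCusp x →
        (ThetaSetting.modelχ' p).IsCusp x' → x' = x) ∧
      (∀ x : (ThetaSetting.modelχ' p).Pt, (ThetaSetting.modelχ' p).IsCusp x →
        ∃ s : ↥(ThetaSetting.modelχ' p).GK →* (ThetaSetting.modelχ' p).PiTemp, Continuous s ∧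
          (∀ σ, s σ ∈ (ThetaSetting.modelχ' p).decomp x) ∧
          ∀ σ, (ThetaSetting.modelχ' p).aug (s σ) = (σ : GQp p)) ∧
      (∀ x : (ThetaSetting.modelχ' p).Pt,
        ¬ ((ThetaSetting.modelχ' p).inertia x).map (ThetaSetting.modelχ' p).toTheta =
            (ThetaSetting.modelχ' p).DeltaTheta) ∧
      ¬ (ThetaSetting.modelχ' p).CuspLaws ∧ Nonempty (ThetaSetting.modelχ' p).OncePuncturedData :=
  ⟨cusp_unique_modelχ' p, exists_continuous_section_modelχ' p, not_map_toTheta_inertia_modelχ' p,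
    not_cuspLaws_modelχ' p, nonempty_oncePuncturedData_modelχ' p⟩

/-! ### Stage 2: `modelχq′` -/

variable (i j : ℤ) (hj : Even j)

/-- Leg C16 at `modelχq′`: the cusp is unique (`Pt := Unit`). [cite: MochizukiEtTh2009, Def 2.1 p.35] -/
theorem cusp_unique_modelχq' :
    ∀ x x' : (ThetaSetting.modelχq' p i j hj).Pt, (ThetaSetting.modelχq' p i j hj).IsCusp x →
      (ThetaSetting.modelχq' p i j hj).IsCusp x' → x' = x :=
  fun _ _ _ _ => rfl

/-- Leg C9 at `modelχq′`: the continuous section `σ ↦ (1, σ)` of `D_x ↠ G_K`.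
[cite: MochizukiEtTh2009, Prop 2.2(ii) p.37] -/
theorem exists_continuous_section_modelχq' :
    ∀ x : (ThetaSetting.modelχq' p i j hj).Pt, (ThetaSetting.modelχq' p i j hj).IsCusp x →
      ∃ s : ↥(ThetaSetting.modelχq' p i j hj).GK →* (ThetaSetting.modelχq' p i j hj).PiTemp,
        Continuous s ∧ (∀ σ, s σ ∈ (ThetaSetting.modelχq' p i j hj).decomp x) ∧
        ∀ σ, (ThetaSetting.modelχq' p i j hj).aug (s σ) = (σ : GQp p) := by
  intro x _
  refine ⟨(SemidirectProduct.inr : GQp p →* PiTpχq p i j).comp (ThetaSetting.modelχq' p i j hj).GK.subtype,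
    (continuous_inrχq p i j).comp continuous_subtype_val, fun σ => ?_, fun σ => rfl⟩
  exact inr_mem_cuspDecomp (actχq p i j) (actχq_stabilises p i j) (σ : GQp p)

/-- Leg C3 FAILS at `modelχq′` (`not_inertiaClause_curveχq'` at `l = 2`). [cite: MochizukiEtTh2009, Def 2.1 p.35] -/
theorem not_map_toTheta_inertia_modelχq' (x : (ThetaSetting.modelχq' p i j hj).Pt) :
    ¬ ((ThetaSetting.modelχq' p i j hj).inertia x).map (ThetaSetting.modelχq' p i j hj).toTheta =
        (ThetaSetting.modelχq' p i j hj).DeltaTheta := fun h =>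
  not_inertiaClause_curveχq' p i j 2 le_rfl x
    ((ThetaSetting.modelχq' p i j hj).inertiaClause_of_map_toTheta x
      ((nonempty_oncePuncturedData_modelχq' p i j hj).some.isCompact_decomp x) h 2 two_pos)

/-- **`¬ CuspLaws` at `modelχq′`**, although `OncePuncturedData` is inhabited there.
[cite: MochizukiEtTh2009, Def 2.1 p.35] -/
theorem not_cuspLaws_modelχq' : ¬ (ThetaSetting.modelχq' p i j hj).CuspLaws := fun hL =>
  not_map_toTheta_inertia_modelχq' p i j hj () (hL.map_toTheta_inertia () trivial)

/-- The truth table at `modelχq′`: C16 ∧ C9 ∧ ¬C3 ∧ ¬CuspLaws ∧ bundle inhabited, for every `(i, j)`, `j` even.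
[cite: MochizukiEtTh2009, Def 2.1 p.35] -/
theorem cuspLaws_census_modelχq' :
    (∀ x x' : (ThetaSetting.modelχq' p i j hj).Pt, (ThetaSetting.modelχq' p i j hj).IsCusp x →
        (ThetaSetting.modelχq' p i j hj).IsCusp x' → x' = x) ∧
      (∀ x : (ThetaSetting.modelχq' p i j hj).Pt, (ThetaSetting.modelχq' p i j hj).IsCusp x →
        ∃ s : ↥(ThetaSetting.modelχq' p i j hj).GK →* (ThetaSetting.modelχq' p i j hj).PiTemp,
          Continuous s ∧ (∀ σ, s σ ∈ (ThetaSetting.modelχq' p i j hj).decomp x) ∧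
          ∀ σ, (ThetaSetting.modelχq' p i j hj).aug (s σ) = (σ : GQp p)) ∧
      (∀ x : (ThetaSetting.modelχq' p i j hj).Pt,
        ¬ ((ThetaSetting.modelχq' p i j hj).inertia x).map (ThetaSetting.modelχq' p i j hj).toTheta =
            (ThetaSetting.modelχq' p i j hj).DeltaTheta) ∧
      ¬ (ThetaSetting.modelχq' p i j hj).CuspLaws ∧
      Nonempty (ThetaSetting.modelχq' p i j hj).OncePuncturedData :=
  ⟨cusp_unique_modelχq' p i j hj, exists_continuous_section_modelχq' p i j hj,
    not_map_toTheta_inertia_modelχq' p i j hj, not_cuspLaws_modelχq' p i j hj,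
    nonempty_oncePuncturedData_modelχq' p i j hj⟩

end Literature.AnabelianGeometry.EtaleTheta.SettingModel

end
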